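import Literature.MathematicalPhysics.QuantumLattice.HubbardRingDecaySharp
import HarnessLib

/-!
# Koma–Tasaki decay for the whole interaction class: Hubbard hopping plus ANY locally
# charge-conserving Hermitian term (arbitrary real functions of the number operators, …)

Trunk T-QLATTICE (family `hubbard`; companions: `HubbardMultiFermionDecaySharp.lean` (square
lattice, sharp power laws), `HubbardRingDecaySharp.lean` (ring, explicit exponential rates) —
both for the PURE grand-canonical Hubbard Hamiltonian `H(t,U) - μN`).

Koma–Tasaki, PRL 68 (1992) 3248, eq. (1) and the paragraph after it: the theorem is stated for
`H = -Σ t_{xy} c†_{xσ} c_{yσ} + V({n_{x,σ}}) + Σ_x h_x · S_x`, where "the interaction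
`V({n_{x,σ}})` is an arbitrary function of the number operators" and "the class of Hamiltonians
considered here includes not only the well studied models like the (standard) Hubbard model or
the periodic Anderson model, but also many of their variants with, e.g., long-range, random or
spin-dependent interactions." The mechanism (eq. (7)): the non-unitary gauge
`G(φ) = exp[-Σ_u φ_u n_u]` commutes with every term that conserves the LOCAL charges
`n_u = n_{u↑} + n_{u↓}`, so such terms drop out of the Hermitian part `U` of eq. (9) and the a
priori bound (10)–(12) does not see them. The tree's formalisation (`hamiltonianWith G t U μ`,
all the `koma_tasaki_*` facts and the sharp companions) covers the standard Hubbard interaction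
`U Σ n_{u↑} n_{u↓} - μN` only. This file proves the printed generality:

* `densityInteraction W` — `V({n_{x,σ}})` for an ARBITRARY real function `W` of the occupation
  configuration (the real diagonal matrix `|s⟩ ↦ W(s)|s⟩` in the occupation basis): Hermitian
  (`isHermitian_densityInteraction`) and gauge invariant
  (`siteGauge_mul_densityInteraction_mul`, eq. (7));
* `norm_thermalCorr_fermionProduct_le_exp_sharp_add` — for `H' = H(t,U) - μN + P` on ANY finite
  graph, `P` any Hermitian matrix with `G(φ) P G(φ)⁻¹ = P`, every real `φ`, `β ≥ 0` and orbital
  lists `l, l'`: the printed a priori bound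
  `|⟨(P_l)† P_{l'}⟩_β| ≤ exp[-Σ_l φ + Σ_{l'} φ] exp[β|t| Σ_a Σ_b [a∼b](cosh(φ_a-φ_b)-1)]`
  — VERBATIM the bound of the pure model (`norm_thermalCorr_fermionProduct_le_exp_sharp`), the
  right-hand side does not depend on `P` (nor on `U`, `μ`);
* `norm_thermalCorr_fermionProduct_torusD_le_exp_sharp_add` — its transport to `(ℤ/Lℤ)^d`;
* `le_exp_ring_of_apriori_flat` — the one-dimensional profile step, model-independently: an a
  priori bound of the above shape with charge `c ≥ 0` and coupling `b ≥ 0` on the ring implies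
  `g ≤ e^{2cq} exp(-[cq - 4b(cosh q - 1)] dist(x,y))` for every `q ≥ 0` (clamped cone
  `ringProfile`, `ringProfile_energy_le`);
* `norm_thermalCorr_multiFermion_ring_le_exp_add` (`_lowT`, `_highT`) — on the ring `ℤ/Lℤ`, for
  `H(t,U) - μN + P` with `P` Hermitian and locally charge conserving: every `n`-fermion local
  product obeys `|⟨(P_x)† P'_y⟩_{β,L}| ≤ e^{2nq} exp(-[nq - 4β|t|(cosh q-1)] dist(x,y))`
  (`q ≥ 0` free), hence `≤ e^{n²/(4β|t|)} exp(-n² dist/(16β|t|))` for `n ≤ 8β|t|` and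
  `≤ e^{2n} exp(-(n/2) dist)` for `8β|t| ≤ n` — the SAME rates as the pure model;
* `norm_thermalCorr_multiFermion_le_sharp_add` — on `(ℤ/Lℤ)²`, same class: the sharp power law
  `|⟨(P_x)† P'_y⟩_{β,L}| ≤ K(q) 5^f (dist(x,y)+1)^{-f}`, `f = 2nq - 4πβ|t|q²`, every `q ≥ 0`
  with `f ≥ 0` — the SAME `η`-lines `η_n = n²/(4πβ|t|)` as the pure model
  (`norm_thermalCorr_multiFermion_le_sharp`);
* `…_densityInteraction` corollaries — the two headline bounds spelled out for
  `H(t,U) - μN + V({n})`.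

Which `P` qualify (all Hermitian operators commuting with every local charge `n_u`): arbitrary
real functions of the occupation numbers (extended / long-range / screened Coulomb / random
density–density interactions, site-dependent potentials, Zeeman fields `h^z_u S^z_u`); on-site
transverse fields and spin-flip terms `h_u · S_u`; inter-site spin exchange `J_{uv} S_u · S_v`
(it conserves `n_u` and `n_v`). NOT covered: terms moving charge (longer-range or complex
hoppings `t_{xy}` — the `t'` case is the companion `HubbardBondPairDecaySharpTTPrime`; pair
hopping; correlated hopping), for which the Hermitian part of `G(φ) H G(φ)⁻¹` changes.

Sources: T. Koma, H. Tasaki, PRL 68 (1992) 3248 (= arXiv:cond-mat/9709068), eq. (1) and the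
following paragraph, eqs. (5)–(13), footnote [10], Theorem (both clauses); O. A. McBryan,
T. Spencer, Commun. Math. Phys. 53 (1977) 299.

## Relation to what the tree already proves

Every statement of the tree about `hamiltonianWith` / `hubbardTorusWith` is the case `P = 0` of
the corresponding statement here (`densityInteraction_zero`); none is changed or superseded. The
generic Gibbs-state bound `norm_gibbsState_le_of_gauge` (`HubbardHubbardModelPairDecayProofs`) is
already model-independent; what this file adds is the observation (eq. (7)) that the Hermitian
part of the gauge-transformed `H + P` equals that of `H` plus `P` (so the SAME perturbation
bound `norm_hoppingPerturbation_le_sharp` applies), and the bookkeeping that carries it through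
the torus transport, the one-dimensional cone and the two-dimensional Euclidean dipole
(`le_rpow_euclid_of_apriori_flat`).

## Mathlib / tree search

Tree: `norm_gibbsState_le_of_gauge` (`HubbardHubbardModelPairDecayProofs`); `siteGauge`,
`siteGauge_eq`, `gaugeMatrix_eq`, `siteGauge_mul_siteGauge_neg`, `siteGauge_inv`,
`isUnit_siteGauge`, `isHermitian_hamiltonianWith`, `siteGauge_conj_hamiltonianWith_add_conjTranspose`
(`HubbardGaugeBound`); `norm_hoppingPerturbation_le_sharp` (`HubbardGaugeBoundSharp`);
`fermionProduct`, `gaugeWeight`, `siteGauge_mul_fermionProductCorr_mul`,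
`norm_fermionProductCorr_le_one`, `multiFermion`, `norm_thermalCorr_multiFermion_le_sharp`
(`HubbardMultiFermionDecaySharp`); `le_rpow_euclid_of_apriori_flat` (`HubbardBondPairDecaySharp`);
`torusFermionProductD`, `multiFermionD`, `multiFermionD_two`, `ringClamp`, `ringProfile`,
`ringProfile_energy_le` (`HubbardRingDecaySharp`); `torusNorm_proj_le_one`
(`HohenbergMerminWagnerPairing`); `lsmPerturbation` (`HubbardLSMFillingProofs`, a different,
charge-moving perturbation — not in this class). Mathlib: `Matrix.diagonal_conjTranspose`,
`Matrix.diagonal_mul_diagonal`, `Matrix.IsHermitian.add`.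
-/

noncomputable section

namespace Literature.MathematicalPhysics.QuantumLattice

open Matrix Finset NormedSpace Literature.Probability.LatticeModels
  Literature.Barriers.HubbardSuperconductivity
open scoped Matrix.Norms.L2Operator ComplexOrder

/-! ### The interaction class on a finite graph -/

section General

variable {Λ : Type*} [LinearOrder Λ] [Fintype Λ] (G : SimpleGraph Λ) [DecidableRel G.Adj]

/-- **Koma–Tasaki's interaction `V({n_{x,σ}})`, "an arbitrary function of the number
operators"**: in the occupation-number basis `|s⟩` (`s` the finite set of occupied orbitals) it
is the real diagonal matrix `|s⟩ ↦ W(s) |s⟩`, `W` an arbitrary real function of the occupation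
configuration (density–density interactions of any range and sign, random potentials, Zeeman
fields, …). Koma–Tasaki, PRL 68 (1992) 3248, eq. (1). [cite: KomaTasakiPRL1992, eq. (1)] -/
def densityInteraction (W : Finset (Orb Λ) → ℝ) : Matrix (Finset (Orb Λ)) (Finset (Orb Λ)) ℂ :=
  diagonal fun s => ((W s : ℝ) : ℂ)

omit [Fintype Λ] in
/-- The zero interaction is the zero matrix (so every statement below contains the pure Hubbard
model `hamiltonianWith G t U μ + 0`). [cite: KomaTasakiPRL1992, eq. (1)] -/
theorem densityInteraction_zero :
    (densityInteraction (fun _ => (0 : ℝ)) : Matrix (Finset (Orb Λ)) (Finset (Orb Λ)) ℂ) = 0 := by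
  unfold densityInteraction
  simp only [Complex.ofReal_zero, diagonal_zero]

omit [Fintype Λ] in
/-- `V({n})` is Hermitian (a real function of commuting Hermitian operators).
Koma–Tasaki, PRL 68 (1992) 3248, eq. (1). [cite: KomaTasakiPRL1992, eq. (1)] -/
theorem isHermitian_densityInteraction (W : Finset (Orb Λ) → ℝ) :
    (densityInteraction W : Matrix (Finset (Orb Λ)) (Finset (Orb Λ)) ℂ).IsHermitian := by
  unfold densityInteraction Matrix.IsHermitian
  rw [diagonal_conjTranspose]
  congr 1
  funext s
  simp only [Pi.star_apply, Complex.star_def, Complex.conj_ofReal]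

/-- **Eq. (7) for the whole class**: the gauge transformation `G(φ) = exp[-Σ_u φ_u n_u]` is
itself a function of the number operators, so it commutes with `V({n})`:
`G(φ) V G(φ)⁻¹ = V`. Koma–Tasaki, PRL 68 (1992) 3248, eq. (7). [cite: KomaTasakiPRL1992, eq. (7)] -/
theorem siteGauge_mul_densityInteraction_mul (φ : Λ → ℝ) (W : Finset (Orb Λ) → ℝ) :
    siteGauge φ * densityInteraction W * siteGauge (-φ) = densityInteraction W := by
  have hc : siteGauge φ * densityInteraction W = densityInteraction W * siteGauge φ := by
    rw [siteGauge_eq, gaugeMatrix_eq]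
    unfold densityInteraction
    rw [diagonal_mul_diagonal, diagonal_mul_diagonal]
    congr 1
    funext s
    ring
  rw [hc, Matrix.mul_assoc, siteGauge_mul_siteGauge_neg, Matrix.mul_one]

/-- The Hamiltonians of the class, `H(t,U) - μN + P` with `P` Hermitian, are Hermitian.
Koma–Tasaki, PRL 68 (1992) 3248, eq. (1). [cite: KomaTasakiPRL1992, eq. (1)] -/
theorem isHermitian_hamiltonianWith_add (t U μ : ℝ)
    {P : Matrix (Finset (Orb Λ)) (Finset (Orb Λ)) ℂ} (hP : P.IsHermitian) :
    (hamiltonianWith G t U μ + P).IsHermitian :=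
  (isHermitian_hamiltonianWith G t U μ).add hP

/-- **Eqs. (7), (9) for the class**: if `P` is Hermitian and gauge invariant, the Hermitian part
of `G(φ)(H + P)G(φ)⁻¹` is `(H + P) + V_φ` with the SAME perturbation
`V_φ = -t T(cosh(φ_u - φ_v) - 1)` as for the pure Hubbard Hamiltonian `H = H(t,U) - μN`.
Koma–Tasaki, PRL 68 (1992) 3248, eqs. (7), (9). [cite: KomaTasakiPRL1992, eqs. (7) and (9)] -/
theorem siteGauge_conj_hamiltonianWith_add_add_conjTranspose (φ : Λ → ℝ) (t U μ : ℝ)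
    {P : Matrix (Finset (Orb Λ)) (Finset (Orb Λ)) ℂ} (hP : P.IsHermitian)
    (hPφ : siteGauge φ * P * siteGauge (-φ) = P) :
    siteGauge φ * (hamiltonianWith G t U μ + P) * siteGauge (-φ) +
        (siteGauge φ * (hamiltonianWith G t U μ + P) * siteGauge (-φ))ᴴ =
      (2 : ℂ) • (hamiltonianWith G t U μ + P +
        -(t : ℂ) • hoppingForm G (fun u v => Real.cosh (φ u - φ v) - 1)) := by
  have h0 := siteGauge_conj_hamiltonianWith_add_conjTranspose G φ t U μ
  rw [Matrix.mul_add, Matrix.add_mul, hPφ, conjTranspose_add, hP.eq]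
  calc siteGauge φ * hamiltonianWith G t U μ * siteGauge (-φ) + P +
        ((siteGauge φ * hamiltonianWith G t U μ * siteGauge (-φ))ᴴ + P)
      = siteGauge φ * hamiltonianWith G t U μ * siteGauge (-φ) +
          (siteGauge φ * hamiltonianWith G t U μ * siteGauge (-φ))ᴴ + (2 : ℂ) • P := by
        rw [two_smul]; abel
    _ = (2 : ℂ) • (hamiltonianWith G t U μ +
          -(t : ℂ) • hoppingForm G (fun u v => Real.cosh (φ u - φ v) - 1)) + (2 : ℂ) • P := by
        rw [h0]
    _ = (2 : ℂ) • (hamiltonianWith G t U μ + P +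
          -(t : ℂ) • hoppingForm G (fun u v => Real.cosh (φ u - φ v) - 1)) := by
        rw [← smul_add]
        congr 1
        abel

/-- **Koma–Tasaki's a priori bound for the whole class, printed constant** (eqs. (6)–(12)
before the choice of `φ`, footnote [10]): on an arbitrary finite graph, for `H' = H(t,U) - μN + P`
with `P` Hermitian and `G(φ) P G(φ)⁻¹ = P`, `β ≥ 0` and orbital lists `l, l'`,
`|⟨(P_l)† P_{l'}⟩_β| ≤ exp[-Σ_{(u,σ)∈l} φ_u + Σ_{(v,τ)∈l'} φ_v] exp[β|t| Σ_a Σ_b [a∼b](cosh(φ_a-φ_b)-1)]`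
— the right-hand side is that of the pure model and does not depend on `P`, `U`, `μ`.
[cite: KomaTasakiPRL1992, eq. (1), eqs. (6)–(12) and footnote [10]] -/
theorem norm_thermalCorr_fermionProduct_le_exp_sharp_add (t U μ : ℝ)
    {P : Matrix (Finset (Orb Λ)) (Finset (Orb Λ)) ℂ} (hP : P.IsHermitian) (φ : Λ → ℝ)
    (hPφ : siteGauge φ * P * siteGauge (-φ) = P) {β : ℝ} (hβ : 0 ≤ β)
    (l l' : List (Λ × Fin 2)) :
    ‖(hamiltonianWith G t U μ + P).thermalCorr β (fermionProduct l)ᴴ (fermionProduct l')‖ ≤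
      Real.exp (-gaugeWeight φ l + gaugeWeight φ l') *
        Real.exp (β * (|t| * ∑ a : Λ, ∑ b : Λ,
          if G.Adj a b then (Real.cosh (φ a - φ b) - 1) else 0)) := by
  set H : Matrix (Finset (Orb Λ)) (Finset (Orb Λ)) ℂ := hamiltonianWith G t U μ + P with hH_def
  set A : Matrix (Finset (Orb Λ)) (Finset (Orb Λ)) ℂ := (fermionProduct l)ᴴ * fermionProduct l'
    with hA_def
  set V : Matrix (Finset (Orb Λ)) (Finset (Orb Λ)) ℂ :=
    -(t : ℂ) • hoppingForm G (fun a b => Real.cosh (φ a - φ b) - 1) with hV_def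
  set c : ℝ := |t| * ∑ a : Λ, ∑ b : Λ,
    if G.Adj a b then (Real.cosh (φ a - φ b) - 1) else 0 with hc_def
  set κ : ℝ := Real.exp (-gaugeWeight φ l + gaugeWeight φ l') with hκ_def
  have hH : H.IsHermitian := (isHermitian_hamiltonianWith G t U μ).add hP
  have hD : IsUnit (siteGauge φ) := isUnit_siteGauge φ
  have hA : siteGauge φ * A * (siteGauge φ)⁻¹ = ((κ : ℝ) : ℂ) • A := by
    rw [siteGauge_inv]
    exact siteGauge_mul_fermionProductCorr_mul φ l l'
  have hV : siteGauge φ * H * (siteGauge φ)⁻¹ + (siteGauge φ * H * (siteGauge φ)⁻¹)ᴴ =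
      (2 : ℂ) • (H + V) := by
    rw [siteGauge_inv]
    exact siteGauge_conj_hamiltonianWith_add_add_conjTranspose G φ t U μ hP hPφ
  have hc : ‖V‖ ≤ c := norm_hoppingPerturbation_le_sharp G φ t
  have h := norm_gibbsState_le_of_gauge hH hD hA hV hc hβ
  have hκ : ‖((κ : ℝ) : ℂ)‖ = κ := by
    rw [Complex.norm_real, Real.norm_of_nonneg (Real.exp_pos _).le]
  have hthermal : H.thermalCorr β (fermionProduct l)ᴴ (fermionProduct l') = gibbsState β H A :=
    rfl
  rw [hthermal]
  calc ‖gibbsState β H A‖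
      ≤ ‖((κ : ℝ) : ℂ)‖ * ‖A‖ * Real.exp (β * c) := h
    _ ≤ ‖((κ : ℝ) : ℂ)‖ * 1 * Real.exp (β * c) := by
        gcongr
        exact norm_fermionProductCorr_le_one l l'
    _ = κ * Real.exp (β * c) := by rw [hκ]; ring

end General

/-! ### Transport to the discrete torus `(ℤ/Lℤ)^d` -/

section TorusD

variable {d L : ℕ} [NeZero L]

/-- A flat potential weighs a list by its length. [folklore] -/
private theorem sum_map_eq_length_mulP {α : Type*} (φ : α → ℝ) (c : ℝ) (l : List (α × Fin 2))
    (h : ∀ p ∈ l, φ p.1 = c) : (l.map fun p => φ p.1).sum = (l.length : ℝ) * c := by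
  induction l with
  | nil => simp
  | cons p l ih =>
      rw [List.map_cons, List.sum_cons, List.length_cons, h p (by simp),
        ih (fun q hq => h q (by simp [hq]))]
      push_cast
      ring

/-- **The printed a priori bound on `(ℤ/Lℤ)^d` for the whole class, flat potentials**: for
`H' = H(t,U) - μN + P` on the fermionic torus, `P` Hermitian and invariant under every site
gauge, `β ≥ 0`, and a potential `φ` constant (`= φ x`) on the sites of `l` and (`= φ y`) on the
sites of `l'`:
`|⟨(P_l)† P_{l'}⟩_{β,L}| ≤ e^{-|l| φ_x + |l'| φ_y} exp[β|t| Σ_a Σ_b [a∼b](cosh(φ_a-φ_b)-1)]`.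
[cite: KomaTasakiPRL1992, eq. (1), eqs. (6)–(12) and footnote [10]] -/
theorem norm_thermalCorr_fermionProduct_torusD_le_exp_sharp_add (t U μ : ℝ)
    {P : Matrix (Finset (Orb (FermionTorus d L))) (Finset (Orb (FermionTorus d L))) ℂ}
    (hP : P.IsHermitian)
    (hPg : ∀ ψ : FermionTorus d L → ℝ, siteGauge ψ * P * siteGauge (-ψ) = P)
    {β : ℝ} (hβ : 0 ≤ β) (φ : TorusSite d L → ℝ) (x y : TorusSite d L)
    (l l' : List (TorusSite d L × Fin 2))
    (hx : ∀ p ∈ l, φ p.1 = φ x) (hy : ∀ p ∈ l', φ p.1 = φ y) :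
    ‖(hubbardTorusWith d L t U μ + P).thermalCorr β
        (torusFermionProductD d l)ᴴ (torusFermionProductD d l')‖ ≤
      Real.exp (-((l.length : ℝ) * φ x) + (l'.length : ℝ) * φ y) * Real.exp (β * |t| *
        ∑ a : TorusSite d L, ∑ b : TorusSite d L,
          (if (torusGraph d L).Adj a b then (Real.cosh (φ a - φ b) - 1) else 0)) := by
  have key := norm_thermalCorr_fermionProduct_le_exp_sharp_add (fermionTorusGraph d L) t U μ hP
    (fun u => φ (FermionTorus.toTorusSite u)) (hPg _) hβ
    (l.map fun p => (FermionTorus.ofTorusSite p.1, p.2))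
    (l'.map fun p => (FermionTorus.ofTorusSite p.1, p.2))
  have hsumeq : (∑ u : FermionTorus d L, ∑ v : FermionTorus d L,
      if (fermionTorusGraph d L).Adj u v then
        (Real.cosh (φ (FermionTorus.toTorusSite u) - φ (FermionTorus.toTorusSite v)) - 1)
      else 0) =
      ∑ a : TorusSite d L, ∑ b : TorusSite d L,
        if (torusGraph d L).Adj a b then (Real.cosh (φ a - φ b) - 1) else 0 := by
    refine Fintype.sum_equiv FermionTorus.equivTorusSite _ _ fun u => ?_
    refine Fintype.sum_equiv FermionTorus.equivTorusSite _ _ fun v => ?_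
    simp [FermionTorus.equivTorusSite]
  rw [hsumeq, gaugeWeight_map_ofTorusSiteD, gaugeWeight_map_ofTorusSiteD,
    sum_map_eq_length_mulP φ (φ x) l hx, sum_map_eq_length_mulP φ (φ y) l' hy] at key
  unfold torusFermionProductD
  refine Eq.trans_le ?_ (key.trans_eq ?_)
  · congr!
  · ring

/-- The support of `P_x` lies in the unit neighbourhood of `x` when all steps have coordinates
in `{0, 1, -1}`: a potential flat there is constant on the support. [folklore] -/
private theorem flat_on_ofFnP {n : ℕ} (δ : Fin n → Site d) (σ : Fin n → Fin 2)
    (hδ : ∀ i j, δ i j = 0 ∨ δ i j = 1 ∨ δ i j = -1) (φ : TorusSite d L → ℝ) (x : TorusSite d L)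
    (hflat : ∀ u, torusDist u x ≤ 1 → φ u = φ x) :
    ∀ p ∈ (List.ofFn fun i => (x + Torus.proj L (δ i), σ i)), φ p.1 = φ x := by
  intro p hp
  rw [List.mem_ofFn] at hp
  obtain ⟨i, rfl⟩ := hp
  refine hflat _ ?_
  show torusNorm (x + Torus.proj L (δ i) - x) ≤ 1
  rw [add_sub_cancel_left]
  exact torusNorm_proj_le_one L (hδ i)

/-- **A priori: `|⟨(P_x)† P'_y⟩_{β,L}| ≤ 1`** for the whole class (`φ = 0`; `‖P_x‖ ≤ 1`).
[cite: KomaTasakiPRL1992, eq. (1), eq. (10) and footnote [10]] -/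
theorem norm_thermalCorr_multiFermionD_add_le_one {n : ℕ} (δ δ' : Fin n → Site d)
    (σ σ' : Fin n → Fin 2) (t U μ β : ℝ) (hβ : 0 ≤ β)
    {P : Matrix (Finset (Orb (FermionTorus d L))) (Finset (Orb (FermionTorus d L))) ℂ}
    (hP : P.IsHermitian)
    (hPg : ∀ ψ : FermionTorus d L → ℝ, siteGauge ψ * P * siteGauge (-ψ) = P)
    (x y : TorusSite d L) :
    ‖(hubbardTorusWith d L t U μ + P).thermalCorr β
        (multiFermionD d δ σ L x)ᴴ (multiFermionD d δ' σ' L y)‖ ≤ 1 := by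
  have h := norm_thermalCorr_fermionProduct_torusD_le_exp_sharp_add (d := d) t U μ hP hPg hβ
    (fun _ => 0) x y (List.ofFn fun i => (x + Torus.proj L (δ i), σ i))
    (List.ofFn fun i => (y + Torus.proj L (δ' i), σ' i)) (fun _ _ => rfl) (fun _ _ => rfl)
  simp only [mul_zero, neg_zero, add_zero, Real.exp_zero, one_mul, sub_self, Real.cosh_zero,
    ite_self, Finset.sum_const_zero] at h
  unfold multiFermionD
  exact h

end TorusD

/-! ### The one-dimensional profile step, model-independently -/

section Ring

variable {L : ℕ} [NeZero L]

omit [NeZero L] in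
/-- Inside the unit ball around `x` the clamp is `1` (for `R ≥ 1`). [folklore] -/
private theorem ringClamp_of_dist_le_oneP {x u : TorusSite 1 L} {R : ℕ} (hR : 1 ≤ R)
    (hu : torusDist u x ≤ 1) : ringClamp x R u = 1 := by
  unfold ringClamp
  rw [max_eq_right hu, min_eq_left hR]

omit [NeZero L] in
/-- Beyond radius `R` the clamp is `R`. [folklore] -/
private theorem ringClamp_of_le_distP {x u : TorusSite 1 L} {R : ℕ} (hu : R ≤ torusDist u x) :
    ringClamp x R u = R := by
  unfold ringClamp
  exact min_eq_right (le_max_of_le_left hu)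

/-- **The one-dimensional clause, as a model-independent profile step** (Theorem, last clause;
eqs. (12), (13) with the linear profile): on the ring `ℤ/Lℤ`, if a real number `g` satisfies,
for every potential `φ` that is constant on the unit neighbourhoods of `x` and of `y`, the a
priori bound `g ≤ e^{-c(φ_x - φ_y)} exp[b Σ_u Σ_v [u∼v](cosh(φ_u-φ_v)-1)]` with a charge `c ≥ 0`
and a coupling `b ≥ 0`, then for every `q ≥ 0`
`g ≤ e^{2cq} exp(-[cq - 4b(cosh q - 1)] dist(x,y))` (the clamped cone `ringProfile`: gain
`cq(dist - 2)`, energy `≤ 4b(dist - 1)(cosh q - 1)`).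
[cite: KomaTasakiPRL1992, Theorem (one-dimensional clause), eqs. (12)–(13)] [cite: McBryanSpencer1977] -/
theorem le_exp_ring_of_apriori_flat (L : ℕ) [NeZero L] (b c q g : ℝ) (hb : 0 ≤ b) (hc : 0 ≤ c)
    (hq : 0 ≤ q) (x y : TorusSite 1 L)
    (hAP : ∀ φ : TorusSite 1 L → ℝ, (∀ u, torusDist u x ≤ 1 → φ u = φ x) →
      (∀ v, torusDist v y ≤ 1 → φ v = φ y) →
      g ≤ Real.exp (-(c * (φ x - φ y))) * Real.exp (b *
          ∑ u : TorusSite 1 L, ∑ v : TorusSite 1 L,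
            (if (torusGraph 1 L).Adj u v then (Real.cosh (φ u - φ v) - 1) else 0))) :
    g ≤ Real.exp (2 * c * q) *
      Real.exp (-((c * q - 4 * b * (Real.cosh q - 1)) * (torusDist x y : ℝ))) := by
  have hC : 0 ≤ Real.cosh q - 1 := sub_nonneg.2 (Real.one_le_cosh q)
  rw [← Real.exp_add]
  rcases le_or_gt (torusDist x y) 1 with hr1 | hr2
  · -- short distances: `g ≤ 1` from the flat potential `φ = 0`
    have h0 := hAP (fun _ => 0) (fun _ _ => rfl) (fun _ _ => rfl)
    simp only [sub_self, mul_zero, neg_zero, Real.cosh_zero, ite_self, sum_const_zero,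
      Real.exp_zero, mul_one] at h0
    refine h0.trans (Real.one_le_exp ?_)
    have hr1' : (torusDist x y : ℝ) ≤ 1 := by exact_mod_cast hr1
    have hr0 : (0 : ℝ) ≤ torusDist x y := Nat.cast_nonneg _
    have hcq : 0 ≤ c * q := mul_nonneg hc hq
    nlinarith [mul_nonneg (mul_nonneg hb hC) hr0, mul_nonneg hcq (sub_nonneg.2 hr1')]
  · -- `r ≥ 2`: the clamped cone with `R = r - 1`
    set r : ℕ := torusDist x y with hr
    have hR1 : 1 ≤ r - 1 := by omega
    set φ : TorusSite 1 L → ℝ := ringProfile x (r - 1) q with hφ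
    have hflx : ∀ u, torusDist u x ≤ 1 → φ u = φ x := by
      intro u hu
      simp only [hφ, ringProfile, ringClamp_of_dist_le_oneP hR1 hu,
        ringClamp_of_dist_le_oneP hR1 (show torusDist x x ≤ 1 by simp)]
    have hfar : ∀ u, torusDist u y ≤ 1 → r - 1 ≤ torusDist u x := by
      intro u hu
      have htri : torusDist x y ≤ torusDist x u + torusDist u y := torusDist_triangle' x u y
      rw [torusDist_comm' x u] at htri
      omega
    have hfly : ∀ u, torusDist u y ≤ 1 → φ u = φ y := by
      intro u hu
      have hy0 : r - 1 ≤ torusDist y x := hfar y (by simp)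
      simp only [hφ, ringProfile, ringClamp_of_le_distP (hfar u hu), ringClamp_of_le_distP hy0]
    have key := hAP φ hflx hfly
    rw [← Real.exp_add] at key
    have hφx : φ x = -q := by
      simp only [hφ, ringProfile, ringClamp_of_dist_le_oneP hR1 (show torusDist x x ≤ 1 by simp),
        Nat.cast_one, mul_one]
    have hφy : φ y = -(q * ((r - 1 : ℕ) : ℝ)) := by
      simp only [hφ, ringProfile, ringClamp_of_le_distP (hfar y (by simp))]
    have hE := ringProfile_energy_le x (r - 1) hq
    have hE' : b * ∑ u : TorusSite 1 L, ∑ v : TorusSite 1 L,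
        (if (torusGraph 1 L).Adj u v then (Real.cosh (φ u - φ v) - 1) else 0) ≤
        b * (4 * ((r - 1 : ℕ) : ℝ) * (Real.cosh q - 1)) :=
      mul_le_mul_of_nonneg_left hE hb
    have hcast : ((r - 1 : ℕ) : ℝ) = (r : ℝ) - 1 := by
      rw [Nat.cast_sub (by omega : 1 ≤ r), Nat.cast_one]
    refine key.trans (Real.exp_le_exp.2 ?_)
    rw [hφx, hφy, hcast]
    rw [hcast] at hE'
    have hcq : 0 ≤ c * q := mul_nonneg hc hq
    nlinarith [mul_nonneg hb hC]

/-! ### Exponential clustering on the ring for the whole class -/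

/-- **Sharp one-dimensional Koma–Tasaki bound for the whole interaction class** (Theorem,
one-dimensional clause; eq. (1); footnote [10]): on the ring `ℤ/Lℤ` with Hamiltonian
`H(t,U) - μN + P`, `P` any Hermitian matrix invariant under every site gauge (arbitrary real
functions of the number operators, …), for all real `t, U, μ`, `β ≥ 0`, every `q ≥ 0`, steps
`δ_i, δ'_i ∈ {0, ±1}`, arbitrary spins and all sites `x, y`:
`|⟨(P_x)† P'_y⟩_{β,L}| ≤ e^{2nq} exp(-[nq - 4β|t|(cosh q - 1)] dist(x,y))` — the bound of the
pure model (`norm_thermalCorr_multiFermion_ring_le_exp`), unchanged.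
[cite: KomaTasakiPRL1992, eq. (1), Theorem (one-dimensional clause), eqs. (5)–(13), footnote [10]] [cite: McBryanSpencer1977] -/
theorem norm_thermalCorr_multiFermion_ring_le_exp_add (L : ℕ) [NeZero L] {n : ℕ}
    (δ δ' : Fin n → Site 1) (σ σ' : Fin n → Fin 2)
    (hδ : ∀ i j, δ i j = 0 ∨ δ i j = 1 ∨ δ i j = -1)
    (hδ' : ∀ i j, δ' i j = 0 ∨ δ' i j = 1 ∨ δ' i j = -1)
    (t U μ β q : ℝ) (hβ : 0 ≤ β) (hq : 0 ≤ q)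
    {P : Matrix (Finset (Orb (FermionTorus 1 L))) (Finset (Orb (FermionTorus 1 L))) ℂ}
    (hP : P.IsHermitian)
    (hPg : ∀ ψ : FermionTorus 1 L → ℝ, siteGauge ψ * P * siteGauge (-ψ) = P)
    (x y : TorusSite 1 L) :
    ‖(hubbardTorusWith 1 L t U μ + P).thermalCorr β
        (multiFermionD 1 δ σ L x)ᴴ (multiFermionD 1 δ' σ' L y)‖ ≤
      Real.exp (2 * n * q) *
        Real.exp (-((n * q - 4 * (β * |t|) * (Real.cosh q - 1)) * (torusDist x y : ℝ))) := by
  refine le_exp_ring_of_apriori_flat L (β * |t|) n q _ (mul_nonneg hβ (abs_nonneg t))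
    (Nat.cast_nonneg n) hq x y (fun φ hfx hfy => ?_)
  have key := norm_thermalCorr_fermionProduct_torusD_le_exp_sharp_add (d := 1) t U μ hP hPg hβ
    φ x y (List.ofFn fun i => (x + Torus.proj L (δ i), σ i))
    (List.ofFn fun i => (y + Torus.proj L (δ' i), σ' i))
    (flat_on_ofFnP δ σ hδ φ x hfx) (flat_on_ofFnP δ' σ' hδ' φ y hfy)
  rw [List.length_ofFn, List.length_ofFn] at key
  have he : -((n : ℝ) * φ x) + (n : ℝ) * φ y = -((n : ℝ) * (φ x - φ y)) := by ring
  rw [he] at key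
  unfold multiFermionD
  exact key

/-- **Low temperatures, whole class: inverse correlation length `≥ n²T/(16|t|)`**: if
`n ≤ 8β|t|` then, with `q = n/(8β|t|)`,
`|⟨(P_x)† P'_y⟩_{β,L}| ≤ e^{n²/(4β|t|)} exp(-n² dist(x,y)/(16β|t|))`, uniformly in `L`, for all
real `U`, `μ` and every admissible `P`. [cite: KomaTasakiPRL1992, eq. (1), Theorem (one-dimensional clause) and p. 3249] -/
theorem norm_thermalCorr_multiFermion_ring_le_exp_add_lowT (L : ℕ) [NeZero L] {n : ℕ}
    (δ δ' : Fin n → Site 1) (σ σ' : Fin n → Fin 2)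
    (hδ : ∀ i j, δ i j = 0 ∨ δ i j = 1 ∨ δ i j = -1)
    (hδ' : ∀ i j, δ' i j = 0 ∨ δ' i j = 1 ∨ δ' i j = -1)
    (t U μ β : ℝ) (hβ : 0 ≤ β) (hn : (n : ℝ) ≤ 8 * (β * |t|))
    {P : Matrix (Finset (Orb (FermionTorus 1 L))) (Finset (Orb (FermionTorus 1 L))) ℂ}
    (hP : P.IsHermitian)
    (hPg : ∀ ψ : FermionTorus 1 L → ℝ, siteGauge ψ * P * siteGauge (-ψ) = P)
    (x y : TorusSite 1 L) :
    ‖(hubbardTorusWith 1 L t U μ + P).thermalCorr β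
        (multiFermionD 1 δ σ L x)ᴴ (multiFermionD 1 δ' σ' L y)‖ ≤
      Real.exp ((n : ℝ) ^ 2 / (4 * (β * |t|))) *
        Real.exp (-((n : ℝ) ^ 2 / (16 * (β * |t|)) * (torusDist x y : ℝ))) := by
  rcases Nat.eq_zero_or_pos n with hn0 | hnpos
  · subst hn0
    have h := norm_thermalCorr_multiFermion_ring_le_exp_add L δ δ' σ σ' hδ hδ' t U μ β 0 hβ
      le_rfl hP hPg x y
    simpa using h
  set b : ℝ := β * |t| with hb
  have hbpos : 0 < b := by
    have : (0 : ℝ) < n := by exact_mod_cast hnpos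
    nlinarith
  set q : ℝ := n / (8 * b) with hq
  have hq0 : 0 ≤ q := by positivity
  have hq1 : q ≤ 1 := by
    rw [hq, div_le_one (by positivity)]
    exact hn
  have h := norm_thermalCorr_multiFermion_ring_le_exp_add L δ δ' σ σ' hδ hδ' t U μ β q hβ hq0
    hP hPg x y
  have hcosh : Real.cosh q - 1 ≤ q ^ 2 :=
    cosh_sub_one_le_sq (s := q) (by rw [abs_of_nonneg hq0]; exact hq1)
  have h2nq : 2 * (n : ℝ) * q = (n : ℝ) ^ 2 / (4 * b) := by
    rw [hq]; field_simp; ring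
  have hm : (n : ℝ) ^ 2 / (16 * b) ≤ n * q - 4 * b * (Real.cosh q - 1) := by
    have h4b : 4 * b * (Real.cosh q - 1) ≤ 4 * b * q ^ 2 :=
      mul_le_mul_of_nonneg_left hcosh (by positivity)
    have hval : (n : ℝ) * q - 4 * b * q ^ 2 = (n : ℝ) ^ 2 / (16 * b) := by
      rw [hq]; field_simp; ring
    linarith
  refine h.trans ?_
  rw [h2nq]
  refine mul_le_mul_of_nonneg_left (Real.exp_le_exp.2 ?_) (Real.exp_pos _).le
  have hr0 : (0 : ℝ) ≤ torusDist x y := Nat.cast_nonneg _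
  nlinarith

/-- **High temperatures, whole class** (`8β|t| ≤ n`): with `q = 1`,
`|⟨(P_x)† P'_y⟩_{β,L}| ≤ e^{2n} exp(-(n/2) dist(x,y))`, uniformly in `L`, all real `U`, `μ`,
every admissible `P`. [cite: KomaTasakiPRL1992, eq. (1), Theorem (one-dimensional clause) and p. 3249] -/
theorem norm_thermalCorr_multiFermion_ring_le_exp_add_highT (L : ℕ) [NeZero L] {n : ℕ}
    (δ δ' : Fin n → Site 1) (σ σ' : Fin n → Fin 2)
    (hδ : ∀ i j, δ i j = 0 ∨ δ i j = 1 ∨ δ i j = -1)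
    (hδ' : ∀ i j, δ' i j = 0 ∨ δ' i j = 1 ∨ δ' i j = -1)
    (t U μ β : ℝ) (hβ : 0 ≤ β) (hn : 8 * (β * |t|) ≤ n)
    {P : Matrix (Finset (Orb (FermionTorus 1 L))) (Finset (Orb (FermionTorus 1 L))) ℂ}
    (hP : P.IsHermitian)
    (hPg : ∀ ψ : FermionTorus 1 L → ℝ, siteGauge ψ * P * siteGauge (-ψ) = P)
    (x y : TorusSite 1 L) :
    ‖(hubbardTorusWith 1 L t U μ + P).thermalCorr β
        (multiFermionD 1 δ σ L x)ᴴ (multiFermionD 1 δ' σ' L y)‖ ≤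
      Real.exp (2 * n) * Real.exp (-((n : ℝ) / 2 * (torusDist x y : ℝ))) := by
  have h := norm_thermalCorr_multiFermion_ring_le_exp_add L δ δ' σ σ' hδ hδ' t U μ β 1 hβ
    zero_le_one hP hPg x y
  have hcosh : Real.cosh 1 - 1 ≤ 1 := by
    have := cosh_sub_one_le_sq (s := (1 : ℝ)) (by norm_num)
    simpa using this
  have hb : 0 ≤ β * |t| := mul_nonneg hβ (abs_nonneg t)
  rw [mul_one] at h
  refine h.trans (mul_le_mul_of_nonneg_left (Real.exp_le_exp.2 ?_) (Real.exp_pos _).le)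
  have hr0 : (0 : ℝ) ≤ torusDist x y := Nat.cast_nonneg _
  have hm : (n : ℝ) / 2 ≤ n * 1 - 4 * (β * |t|) * (Real.cosh 1 - 1) := by
    nlinarith [mul_le_mul_of_nonneg_left hcosh (by positivity : (0 : ℝ) ≤ 4 * (β * |t|))]
  nlinarith

/-- **The headline for `V({n})` spelled out**: on the ring, for `H(t,U) - μN + V({n})` with `W`
an ARBITRARY real function of the occupation configuration and `n ≤ 8β|t|`,
`|⟨(P_x)† P'_y⟩_{β,L}| ≤ e^{n²/(4β|t|)} exp(-n² dist(x,y)/(16β|t|))` — correlation length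
`ξ_n ≤ 16|t|/(n²T)` independently of `W`, `U`, `μ`.
[cite: KomaTasakiPRL1992, eq. (1), Theorem (one-dimensional clause)] -/
theorem norm_thermalCorr_multiFermion_ring_densityInteraction_le_exp_lowT (L : ℕ) [NeZero L]
    {n : ℕ} (δ δ' : Fin n → Site 1) (σ σ' : Fin n → Fin 2)
    (hδ : ∀ i j, δ i j = 0 ∨ δ i j = 1 ∨ δ i j = -1)
    (hδ' : ∀ i j, δ' i j = 0 ∨ δ' i j = 1 ∨ δ' i j = -1)
    (t U μ β : ℝ) (hβ : 0 ≤ β) (hn : (n : ℝ) ≤ 8 * (β * |t|))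
    (W : Finset (Orb (FermionTorus 1 L)) → ℝ) (x y : TorusSite 1 L) :
    ‖(hubbardTorusWith 1 L t U μ + densityInteraction W).thermalCorr β
        (multiFermionD 1 δ σ L x)ᴴ (multiFermionD 1 δ' σ' L y)‖ ≤
      Real.exp ((n : ℝ) ^ 2 / (4 * (β * |t|))) *
        Real.exp (-((n : ℝ) ^ 2 / (16 * (β * |t|)) * (torusDist x y : ℝ))) :=
  norm_thermalCorr_multiFermion_ring_le_exp_add_lowT L δ δ' σ σ' hδ hδ' t U μ β hβ hn
    (isHermitian_densityInteraction W) (fun ψ => siteGauge_mul_densityInteraction_mul ψ W) x y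

end Ring

/-! ### The square lattice: the sharp power law for the whole class -/

section Square

variable {L : ℕ} [NeZero L]

/-- For a step `e ∈ {0, ±e₁, ±e₂}`, `|proj e|₂² ≤ 1` on `(ℤ/Lℤ)²`. [folklore] -/
private theorem torusNormSq_proj_le_oneP (L : ℕ) [NeZero L] {e : Site 2}
    (he : e ∈ insert (0 : Site 2) unitSteps) : torusNormSq (Torus.proj L e) ≤ 1 := by
  have hmax : torusNorm (Torus.proj L e : TorusSite 2 L) ≤ 1 :=
    torusNorm_proj_le_one L (apply_mem_insert_unitSteps he)
  rw [torusNorm_two_eq_max] at hmax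
  have h0 : min ((Torus.proj L e : TorusSite 2 L) 0).val
      (L - ((Torus.proj L e : TorusSite 2 L) 0).val) ≤ 1 := le_trans (le_max_left _ _) hmax
  have h1 : min ((Torus.proj L e : TorusSite 2 L) 1).val
      (L - ((Torus.proj L e : TorusSite 2 L) 1).val) ≤ 1 := le_trans (le_max_right _ _) hmax
  have hz : e 0 = 0 ∨ e 1 = 0 := by
    simp only [unitSteps, mem_insert, mem_singleton] at he
    rcases he with rfl | rfl | rfl | rfl | rfl <;> simp
  unfold torusNormSq
  rcases hz with h | h
  · have hc : ((Torus.proj L e : TorusSite 2 L) 0) = 0 := by simp [Torus.proj_apply, h]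
    have hm0 : min (0 : ℕ) (L - 0) = 0 := by simp
    rw [hc, ZMod.val_zero, hm0]
    simpa using Nat.pow_le_pow_left h1 2
  · have hc : ((Torus.proj L e : TorusSite 2 L) 1) = 0 := by simp [Torus.proj_apply, h]
    have hm0 : min (0 : ℕ) (L - 0) = 0 := by simp
    rw [hc, ZMod.val_zero, hm0]
    simpa using Nat.pow_le_pow_left h0 2

/-- A potential flat on the Euclidean unit ball around `x` is constant on the support of `P_x`
when all steps are in `{0, ±e₁, ±e₂}`. [folklore] -/
private theorem flat_on_ofFn2P (L : ℕ) [NeZero L] {n : ℕ} (δ : Fin n → Site 2)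
    (σ : Fin n → Fin 2) (hδ : ∀ i, δ i ∈ insert (0 : Site 2) unitSteps)
    (φ : TorusSite 2 L → ℝ) (x : TorusSite 2 L)
    (hflat : ∀ u, torusNormSq (u - x) ≤ 1 → φ u = φ x) :
    ∀ p ∈ (List.ofFn fun i => (x + Torus.proj L (δ i), σ i)), φ p.1 = φ x := by
  intro p hp
  rw [List.mem_ofFn] at hp
  obtain ⟨i, rfl⟩ := hp
  refine hflat _ ?_
  rw [add_sub_cancel_left]
  exact torusNormSq_proj_le_oneP L (hδ i)

/-- **Sharp Koma–Tasaki bound on `(ℤ/Lℤ)²` for the whole interaction class** (Theorem, eq. (2),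
for the class of eq. (1), in the generality of footnote [10]; printed hopping norm, Euclidean
dipole): for `H(t,U) - μN + P` with `P` Hermitian and invariant under every site gauge, all real
`t, U, μ`, `β ≥ 0`, every `q ≥ 0` with `f := 2nq - 4πβ|t|q² ≥ 0`, steps
`δ_i, δ'_i ∈ {0, ±e₁, ±e₂}`, arbitrary spins and all sites `x, y`:
`|⟨(P_x)† P'_y⟩_{β,L}| ≤ K(q) 5^f (dist(x,y)+1)^{-f}`, `K(q) = exp[2β|t|(2πq²+76q²+544q⁴e^{2q²})]`,
uniformly in `L` — the bound of the pure model (`norm_thermalCorr_multiFermion_le_sharp`),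
unchanged; at `q = n/(4πβ|t|)`, `f = η_n = n²/(4πβ|t|)`.
[cite: KomaTasakiPRL1992, eq. (1), Theorem eq. (2), footnote [10], eqs. (5)–(13)] [cite: McBryanSpencer1977] -/
theorem norm_thermalCorr_multiFermion_le_sharp_add (L : ℕ) [NeZero L] {n : ℕ}
    (δ δ' : Fin n → Site 2) (σ σ' : Fin n → Fin 2)
    (hδ : ∀ i, δ i ∈ insert (0 : Site 2) unitSteps)
    (hδ' : ∀ i, δ' i ∈ insert (0 : Site 2) unitSteps)
    (t U μ β q : ℝ) (hβ : 0 ≤ β) (hq : 0 ≤ q)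
    (hf : 0 ≤ 2 * n * q - 4 * Real.pi * (β * |t|) * q ^ 2)
    {P : Matrix (Finset (Orb (FermionTorus 2 L))) (Finset (Orb (FermionTorus 2 L))) ℂ}
    (hP : P.IsHermitian)
    (hPg : ∀ ψ : FermionTorus 2 L → ℝ, siteGauge ψ * P * siteGauge (-ψ) = P)
    (x y : TorusSite 2 L) :
    ‖(hubbardTorusWith 2 L t U μ + P).thermalCorr β
        (multiFermion δ σ L x)ᴴ (multiFermion δ' σ' L y)‖ ≤
      Real.exp (2 * (β * |t|) *
          (2 * Real.pi * q ^ 2 + 76 * q ^ 2 + 544 * q ^ 4 * Real.exp (2 * q ^ 2))) *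
        ((5 : ℝ) ^ (2 * n * q - 4 * Real.pi * (β * |t|) * q ^ 2) *
          ((torusDist x y : ℝ) + 1) ^ (-(2 * n * q - 4 * Real.pi * (β * |t|) * q ^ 2))) := by
  refine le_rpow_euclid_of_apriori_flat L (β * |t|) n q _ _ (mul_nonneg hβ (abs_nonneg t)) hq
    x y (fun φ hfx hfy => ?_) (by ring) hf
  have h := norm_thermalCorr_fermionProduct_torusD_le_exp_sharp_add (d := 2) t U μ hP hPg hβ
    φ x y (List.ofFn fun i => (x + Torus.proj L (δ i), σ i))
    (List.ofFn fun i => (y + Torus.proj L (δ' i), σ' i))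
    (flat_on_ofFn2P L δ σ hδ φ x hfx) (flat_on_ofFn2P L δ' σ' hδ' φ y hfy)
  rw [List.length_ofFn, List.length_ofFn] at h
  have he : -((n : ℝ) * φ x) + (n : ℝ) * φ y = -((n : ℝ) * (φ x - φ y)) := by ring
  rw [he] at h
  rw [← multiFermionD_two, ← multiFermionD_two]
  unfold multiFermionD
  exact h

/-- **The headline for `V({n})` on the square lattice spelled out**: for `H(t,U) - μN + V({n})`
with `W` an ARBITRARY real function of the occupation configuration, the sharp power law with
the pure model's constants holds for every `n`-fermion local product — the `η`-lines
`η_n = n²T/(4π|t|)` do not depend on `W`, `U`, `μ`.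
[cite: KomaTasakiPRL1992, eq. (1), Theorem eq. (2), footnote [10]] -/
theorem norm_thermalCorr_multiFermion_densityInteraction_le_sharp (L : ℕ) [NeZero L] {n : ℕ}
    (δ δ' : Fin n → Site 2) (σ σ' : Fin n → Fin 2)
    (hδ : ∀ i, δ i ∈ insert (0 : Site 2) unitSteps)
    (hδ' : ∀ i, δ' i ∈ insert (0 : Site 2) unitSteps)
    (t U μ β q : ℝ) (hβ : 0 ≤ β) (hq : 0 ≤ q)
    (hf : 0 ≤ 2 * n * q - 4 * Real.pi * (β * |t|) * q ^ 2)
    (W : Finset (Orb (FermionTorus 2 L)) → ℝ) (x y : TorusSite 2 L) :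
    ‖(hubbardTorusWith 2 L t U μ + densityInteraction W).thermalCorr β
        (multiFermion δ σ L x)ᴴ (multiFermion δ' σ' L y)‖ ≤
      Real.exp (2 * (β * |t|) *
          (2 * Real.pi * q ^ 2 + 76 * q ^ 2 + 544 * q ^ 4 * Real.exp (2 * q ^ 2))) *
        ((5 : ℝ) ^ (2 * n * q - 4 * Real.pi * (β * |t|) * q ^ 2) *
          ((torusDist x y : ℝ) + 1) ^ (-(2 * n * q - 4 * Real.pi * (β * |t|) * q ^ 2))) :=
  norm_thermalCorr_multiFermion_le_sharp_add L δ δ' σ σ' hδ hδ' t U μ β q hβ hq hf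
    (isHermitian_densityInteraction W) (fun ψ => siteGauge_mul_densityInteraction_mul ψ W) x y

end Square

end Literature.MathematicalPhysics.QuantumLattice

end
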